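import Mathlib

/-!
# Piecewise-Toeplitz pencils have short, sparse split Stein generators

Helper for the crux `HiddenCorners` (stmt-MatrixMultiplication-7492), line `Sketch`, registered stub
`stub_piecewise_generators` of `Cruxes/HiddenCorners/Lines/Sketch.lean`.

If each coefficient matrix `T a b : Matrix (Fin N) (Fin N) ℂ` is constant along diagonals except at a set `R₀` of
break rows and a set `C₀` of break columns (both containing index `0`, both of size `≤ d`), and every row and every
column of every `T a b` has at most `s` nonzero entries, then the Stein displacement `T a b − Z (T a b) Zᵀ`
(`Z` = lower shift) equals `G₀ (H₁ a b)ᵀ + (G₁ a b) H₀ᵀ` with CONSTANT `G₀, H₀ : Matrix (Fin N) (Fin d) ℂ` (unit vectors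
at the breaks) and X-dependent parts `G₁ a b, H₁ a b` having at most `4·d·s` nonzero entries per `(a, b)`, hence total
generator sparsity `≤ 4·d·s·r²` — exactly the format of condition (i) of `HiddenCorners`.

Proof: the displacement is supported on the break rows and break columns (elsewhere `T i j = T (i−1) (j−1)`); route the
break rows through `G₀ H₁ᵀ` and the remaining entries of the break columns through `G₁ H₀ᵀ`, numbering the breaks by
`Finset.equivFin`; a row (column) of the displacement has at most `2s` nonzero entries.
-/

set_option linter.dupNamespace false

namespace Summit.MatrixMultiplication.MatrixMultiplication.Cruxes.HiddenCorners.Sketch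

open scoped BigOperators Matrix

/-- Left multiplication by the shift: row `i` of `Z * M` is row `i'` of `M` when `i = i' + 1`. -/
private lemma shift_mul_apply_succ {N : ℕ} (Z : Matrix (Fin N) (Fin N) ℂ)
    (hZ : Z = Matrix.of fun i j : Fin N => if (i : ℕ) = (j : ℕ) + 1 then (1 : ℂ) else 0) (M : Matrix (Fin N) (Fin N) ℂ) (i i' l : Fin N)
    (h : (i : ℕ) = i' + 1) : (Z * M) i l = M i' l := by
  subst hZ
  simp only [Matrix.mul_apply, Matrix.of_apply, ite_mul, one_mul, zero_mul]
  rw [Finset.sum_eq_single i']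
  · simp [h]
  · intro k _ hk
    have : (i : ℕ) ≠ (k : ℕ) + 1 := by
      intro hh; apply hk; apply Fin.ext; omega
    simp [this]
  · intro hh; exact absurd (Finset.mem_univ i') hh

/-- Left multiplication by the shift kills row `0`. -/
private lemma shift_mul_apply_zero {N : ℕ} (Z : Matrix (Fin N) (Fin N) ℂ)
    (hZ : Z = Matrix.of fun i j : Fin N => if (i : ℕ) = (j : ℕ) + 1 then (1 : ℂ) else 0) (M : Matrix (Fin N) (Fin N) ℂ) (i l : Fin N)
    (h : (i : ℕ) = 0) : (Z * M) i l = 0 := by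
  subst hZ
  simp only [Matrix.mul_apply, Matrix.of_apply, ite_mul, one_mul, zero_mul]
  apply Finset.sum_eq_zero
  intro k _
  have : (i : ℕ) ≠ (k : ℕ) + 1 := by omega
  simp [this]

/-- Right multiplication by the transposed shift: column `j` of `W * Zᵀ` is column `j'` of `W` when `j = j' + 1`. -/
private lemma mul_shiftT_apply_succ {N : ℕ} (Z : Matrix (Fin N) (Fin N) ℂ)
    (hZ : Z = Matrix.of fun i j : Fin N => if (i : ℕ) = (j : ℕ) + 1 then (1 : ℂ) else 0) (W : Matrix (Fin N) (Fin N) ℂ) (i j j' : Fin N)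
    (h : (j : ℕ) = j' + 1) : (W * Zᵀ) i j = W i j' := by
  subst hZ
  simp only [Matrix.mul_apply, Matrix.transpose_apply, Matrix.of_apply, mul_ite, mul_one, mul_zero]
  rw [Finset.sum_eq_single j']
  · simp [h]
  · intro k _ hk
    have : (j : ℕ) ≠ (k : ℕ) + 1 := by
      intro hh; apply hk; apply Fin.ext; omega
    simp [this]
  · intro hh; exact absurd (Finset.mem_univ j') hh

/-- Right multiplication by the transposed shift kills column `0`. -/
private lemma mul_shiftT_apply_zero {N : ℕ} (Z : Matrix (Fin N) (Fin N) ℂ)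
    (hZ : Z = Matrix.of fun i j : Fin N => if (i : ℕ) = (j : ℕ) + 1 then (1 : ℂ) else 0) (W : Matrix (Fin N) (Fin N) ℂ) (i j : Fin N)
    (h : (j : ℕ) = 0) : (W * Zᵀ) i j = 0 := by
  subst hZ
  simp only [Matrix.mul_apply, Matrix.transpose_apply, Matrix.of_apply, mul_ite, mul_one, mul_zero]
  apply Finset.sum_eq_zero
  intro k _
  have : (j : ℕ) ≠ (k : ℕ) + 1 := by omega
  simp [this]


/-- Entries of the two-sided shift `Z * M * Zᵀ` at a pair of successor indices. -/
private lemma conj_apply_succ_succ {N : ℕ} (Z : Matrix (Fin N) (Fin N) ℂ)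
    (hZ : Z = Matrix.of fun i j : Fin N => if (i : ℕ) = (j : ℕ) + 1 then (1 : ℂ) else 0) (M : Matrix (Fin N) (Fin N) ℂ) (i i' j j' : Fin N)
    (hi : (i : ℕ) = i' + 1) (hj : (j : ℕ) = j' + 1) :
    (Z * M * Zᵀ) i j = M i' j' := by
  rw [mul_shiftT_apply_succ Z hZ _ i j j' hj, shift_mul_apply_succ Z hZ _ i i' j' hi]

/-- Row `0` of the two-sided shift vanishes. -/
private lemma conj_apply_row_zero {N : ℕ} (Z : Matrix (Fin N) (Fin N) ℂ)
    (hZ : Z = Matrix.of fun i j : Fin N => if (i : ℕ) = (j : ℕ) + 1 then (1 : ℂ) else 0) (M : Matrix (Fin N) (Fin N) ℂ) (i j : Fin N)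
    (hi : (i : ℕ) = 0) : (Z * M * Zᵀ) i j = 0 := by
  simp only [Matrix.mul_apply, Matrix.transpose_apply]
  apply Finset.sum_eq_zero
  intro l _
  have h0 : (Z * M) i l = 0 := shift_mul_apply_zero Z hZ M i l hi
  rw [show (∑ k, Z i k * M k l) = (Z * M) i l from rfl, h0, zero_mul]

/-- Column `0` of the two-sided shift vanishes. -/
private lemma conj_apply_col_zero {N : ℕ} (Z : Matrix (Fin N) (Fin N) ℂ)
    (hZ : Z = Matrix.of fun i j : Fin N => if (i : ℕ) = (j : ℕ) + 1 then (1 : ℂ) else 0) (M : Matrix (Fin N) (Fin N) ℂ) (i j : Fin N)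
    (hj : (j : ℕ) = 0) : (Z * M * Zᵀ) i j = 0 :=
  mul_shiftT_apply_zero Z hZ _ i j hj

/-- Support of a row of `Z * M * Zᵀ`: it injects into the support of the previous row of `M`. -/
private lemma card_row_conj_le {N s : ℕ} (Z : Matrix (Fin N) (Fin N) ℂ)
    (hZ : Z = Matrix.of fun i j : Fin N => if (i : ℕ) = (j : ℕ) + 1 then (1 : ℂ) else 0) (M : Matrix (Fin N) (Fin N) ℂ) (i : Fin N)
    (hrow : ∀ i : Fin N, (Finset.univ.filter fun j : Fin N => M i j ≠ 0).card ≤ s) :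
    (Finset.univ.filter fun j : Fin N => (Z * M * Zᵀ) i j ≠ 0).card ≤ s := by
  classical
  by_cases hi : (i : ℕ) = 0
  · have : (Finset.univ.filter fun j : Fin N => (Z * M * Zᵀ) i j ≠ 0) = ∅ := by
      apply Finset.filter_false_of_mem
      intro j _
      simp [conj_apply_row_zero Z hZ M i j hi]
    simp [this]
  · have hi1 : 1 ≤ (i : ℕ) := Nat.one_le_iff_ne_zero.mpr hi
    set i' : Fin N := ⟨(i : ℕ) - 1, by omega⟩ with hi'
    have hii' : (i : ℕ) = i' + 1 := by simp [hi']; omega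
    refine le_trans ?_ (hrow i')
    apply Finset.card_le_card_of_injOn (fun j : Fin N => (⟨(j : ℕ) - 1, by omega⟩ : Fin N))
    · intro j hj
      simp only [Finset.coe_filter, Finset.mem_univ, true_and, Set.mem_setOf_eq] at hj ⊢
      by_cases hj0 : (j : ℕ) = 0
      · exact absurd (conj_apply_col_zero Z hZ M i j hj0) hj
      · have hjj' : (j : ℕ) = (⟨(j : ℕ) - 1, by omega⟩ : Fin N) + 1 := by simp; omega
        rwa [conj_apply_succ_succ Z hZ M i i' j _ hii' hjj'] at hj
    · intro j hj j₂ hj₂ hjj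
      simp only [Finset.coe_filter, Finset.mem_univ, true_and, Set.mem_setOf_eq] at hj hj₂
      have hj0 : (j : ℕ) ≠ 0 := fun h0 => hj (conj_apply_col_zero Z hZ M i j h0)
      have hj20 : (j₂ : ℕ) ≠ 0 := fun h0 => hj₂ (conj_apply_col_zero Z hZ M i j₂ h0)
      apply Fin.ext
      have := congrArg Fin.val hjj
      simp at this
      omega

/-- Support of a column of `Z * M * Zᵀ`: it injects into the support of the previous column of `M`. -/
private lemma card_col_conj_le {N s : ℕ} (Z : Matrix (Fin N) (Fin N) ℂ)
    (hZ : Z = Matrix.of fun i j : Fin N => if (i : ℕ) = (j : ℕ) + 1 then (1 : ℂ) else 0) (M : Matrix (Fin N) (Fin N) ℂ) (j : Fin N)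
    (hcol : ∀ j : Fin N, (Finset.univ.filter fun i : Fin N => M i j ≠ 0).card ≤ s) :
    (Finset.univ.filter fun i : Fin N => (Z * M * Zᵀ) i j ≠ 0).card ≤ s := by
  classical
  by_cases hj : (j : ℕ) = 0
  · have : (Finset.univ.filter fun i : Fin N => (Z * M * Zᵀ) i j ≠ 0) = ∅ := by
      apply Finset.filter_false_of_mem
      intro i _
      simp [conj_apply_col_zero Z hZ M i j hj]
    simp [this]
  · have hj1 : 1 ≤ (j : ℕ) := Nat.one_le_iff_ne_zero.mpr hj
    set j' : Fin N := ⟨(j : ℕ) - 1, by omega⟩ with hj'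
    have hjj' : (j : ℕ) = j' + 1 := by simp [hj']; omega
    refine le_trans ?_ (hcol j')
    apply Finset.card_le_card_of_injOn (fun i : Fin N => (⟨(i : ℕ) - 1, by omega⟩ : Fin N))
    · intro i hi
      simp only [Finset.coe_filter, Finset.mem_univ, true_and, Set.mem_setOf_eq] at hi ⊢
      by_cases hi0 : (i : ℕ) = 0
      · exact absurd (conj_apply_row_zero Z hZ M i j hi0) hi
      · have hii' : (i : ℕ) = (⟨(i : ℕ) - 1, by omega⟩ : Fin N) + 1 := by simp; omega
        rwa [conj_apply_succ_succ Z hZ M i _ j j' hii' hjj'] at hi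
    · intro i hi i₂ hi₂ hii
      simp only [Finset.coe_filter, Finset.mem_univ, true_and, Set.mem_setOf_eq] at hi hi₂
      have hi0 : (i : ℕ) ≠ 0 := fun h0 => hi (conj_apply_row_zero Z hZ M i j h0)
      have hi20 : (i₂ : ℕ) ≠ 0 := fun h0 => hi₂ (conj_apply_row_zero Z hZ M i₂ j h0)
      apply Fin.ext
      have := congrArg Fin.val hii
      simp at this
      omega

/-- Rows of the displacement `M − Z M Zᵀ` have at most twice the row sparsity of `M`. -/
private lemma card_row_disp_le {N s : ℕ} (Z : Matrix (Fin N) (Fin N) ℂ)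
    (hZ : Z = Matrix.of fun i j : Fin N => if (i : ℕ) = (j : ℕ) + 1 then (1 : ℂ) else 0) (M : Matrix (Fin N) (Fin N) ℂ) (i : Fin N)
    (hrow : ∀ i : Fin N, (Finset.univ.filter fun j : Fin N => M i j ≠ 0).card ≤ s) :
    (Finset.univ.filter fun j : Fin N => (M - Z * M * Zᵀ) i j ≠ 0).card ≤ 2 * s := by
  classical
  calc (Finset.univ.filter fun j : Fin N => (M - Z * M * Zᵀ) i j ≠ 0).card
      ≤ ((Finset.univ.filter fun j : Fin N => M i j ≠ 0) ∪
          (Finset.univ.filter fun j : Fin N => (Z * M * Zᵀ) i j ≠ 0)).card := by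
        apply Finset.card_le_card
        intro j hj
        simp only [Finset.mem_filter, Finset.mem_univ, true_and, Matrix.sub_apply,
          Finset.mem_union] at hj ⊢
        by_contra hcon
        push Not at hcon
        exact hj (by rw [hcon.1, hcon.2]; ring)
    _ ≤ (Finset.univ.filter fun j : Fin N => M i j ≠ 0).card +
          (Finset.univ.filter fun j : Fin N => (Z * M * Zᵀ) i j ≠ 0).card :=
        Finset.card_union_le _ _
    _ ≤ s + s := Nat.add_le_add (hrow i) (card_row_conj_le Z hZ M i hrow)
    _ = 2 * s := by ring

/-- Columns of the displacement `M − Z M Zᵀ` have at most twice the column sparsity of `M`. -/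
private lemma card_col_disp_le {N s : ℕ} (Z : Matrix (Fin N) (Fin N) ℂ)
    (hZ : Z = Matrix.of fun i j : Fin N => if (i : ℕ) = (j : ℕ) + 1 then (1 : ℂ) else 0) (M : Matrix (Fin N) (Fin N) ℂ) (j : Fin N)
    (hcol : ∀ j : Fin N, (Finset.univ.filter fun i : Fin N => M i j ≠ 0).card ≤ s) :
    (Finset.univ.filter fun i : Fin N => (M - Z * M * Zᵀ) i j ≠ 0).card ≤ 2 * s := by
  classical
  calc (Finset.univ.filter fun i : Fin N => (M - Z * M * Zᵀ) i j ≠ 0).card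
      ≤ ((Finset.univ.filter fun i : Fin N => M i j ≠ 0) ∪
          (Finset.univ.filter fun i : Fin N => (Z * M * Zᵀ) i j ≠ 0)).card := by
        apply Finset.card_le_card
        intro i hi
        simp only [Finset.mem_filter, Finset.mem_univ, true_and, Matrix.sub_apply,
          Finset.mem_union] at hi ⊢
        by_contra hcon
        push Not at hcon
        exact hi (by rw [hcon.1, hcon.2]; ring)
    _ ≤ (Finset.univ.filter fun i : Fin N => M i j ≠ 0).card +
          (Finset.univ.filter fun i : Fin N => (Z * M * Zᵀ) i j ≠ 0).card :=
        Finset.card_union_le _ _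
    _ ≤ s + s := Nat.add_le_add (hcol j) (card_col_conj_le Z hZ M j hcol)
    _ = 2 * s := by ring


/-- STUB 4a of line `Sketch` (crux `HiddenCorners`, stmt-MatrixMultiplication-7492) — PIECEWISE-TOEPLITZ pencils with
sparse rows/columns have short sparse split Stein generators.  If every `T a b` is constant along diagonals except at the
break rows `R₀` / break columns `C₀` (both containing index 0, both of size `≤ d`) and has at most `s` nonzero entries in
each row and each column, then the crux's displacement identity holds with `G₀`, `H₀` = unit vectors at the breaks and the
X-dependent generators have at most `4·d·s` nonzero entries per `(a, b)`. -/
theorem stub_piecewise_generators (r N d s : ℕ) (T : Fin r → Fin r → Matrix (Fin N) (Fin N) ℂ)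
    (R₀ C₀ : Finset (Fin N)) (hR : R₀.card ≤ d) (hC : C₀.card ≤ d)
    (h0R : ∀ i : Fin N, (i : ℕ) = 0 → i ∈ R₀) (h0C : ∀ j : Fin N, (j : ℕ) = 0 → j ∈ C₀)
    (hT : ∀ (a b : Fin r) (i j i' j' : Fin N), (i : ℕ) = i' + 1 → (j : ℕ) = j' + 1 → i ∉ R₀ → j ∉ C₀ →
      T a b i j = T a b i' j')
    (hrow : ∀ (a b : Fin r) (i : Fin N), (Finset.univ.filter fun j : Fin N => T a b i j ≠ 0).card ≤ s)
    (hcol : ∀ (a b : Fin r) (j : Fin N), (Finset.univ.filter fun i : Fin N => T a b i j ≠ 0).card ≤ s) :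
    ∃ (G₀ H₀ : Matrix (Fin N) (Fin d) ℂ) (G₁ H₁ : Fin r → Fin r → Matrix (Fin N) (Fin d) ℂ),
      (∀ a b : Fin r,
        T a b - (Matrix.of fun i j : Fin N => if (i : ℕ) = (j : ℕ) + 1 then (1 : ℂ) else 0) * T a b *
            (Matrix.of fun i j : Fin N => if (i : ℕ) = (j : ℕ) + 1 then (1 : ℂ) else 0)ᵀ
          = G₀ * (H₁ a b)ᵀ + G₁ a b * H₀ᵀ) ∧
      (∑ a : Fin r, ∑ b : Fin r,
          ((Finset.univ.filter fun p : Fin N × Fin d => G₁ a b p.1 p.2 ≠ 0).card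
            + (Finset.univ.filter fun p : Fin N × Fin d => H₁ a b p.1 p.2 ≠ 0).card) : ℕ)
        ≤ 4 * d * s * r ^ 2 := by
  classical
  set Z : Matrix (Fin N) (Fin N) ℂ :=
    Matrix.of fun i j : Fin N => if (i : ℕ) = (j : ℕ) + 1 then (1 : ℂ) else 0 with hZ
  -- the displacement of each coefficient matrix
  set D : Fin r → Fin r → Matrix (Fin N) (Fin N) ℂ := fun a b => T a b - Z * T a b * Zᵀ with hD
  -- every index of `Fin N` forces `0 < d` (index 0 is a break)
  have hdpos : ∀ i : Fin N, 0 < d := by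
    intro i
    have h0 : (⟨0, Fin.pos i⟩ : Fin N) ∈ R₀ := h0R _ rfl
    have : 0 < R₀.card := Finset.card_pos.mpr ⟨_, h0⟩
    omega
  -- slots: injective numbering of the break rows / columns inside `Fin d`
  let eR := R₀.equivFin
  let eC := C₀.equivFin
  let slotR : Fin N → Fin d := fun i =>
    if h : i ∈ R₀ then Fin.castLE hR (eR ⟨i, h⟩) else ⟨0, hdpos i⟩
  let slotC : Fin N → Fin d := fun j =>
    if h : j ∈ C₀ then Fin.castLE hC (eC ⟨j, h⟩) else ⟨0, hdpos j⟩
  have slotR_inj : ∀ i i₂ : Fin N, i ∈ R₀ → i₂ ∈ R₀ → slotR i = slotR i₂ → i = i₂ := by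
    intro i i₂ hi hi₂ h
    simp only [slotR, hi, hi₂, dite_true] at h
    have h' : eR ⟨i, hi⟩ = eR ⟨i₂, hi₂⟩ := by
      apply Fin.ext
      have := congrArg Fin.val h
      simpa using this
    have := eR.injective h'
    simpa using this
  have slotC_inj : ∀ j j₂ : Fin N, j ∈ C₀ → j₂ ∈ C₀ → slotC j = slotC j₂ → j = j₂ := by
    intro j j₂ hj hj₂ h
    simp only [slotC, hj, hj₂, dite_true] at h
    have h' : eC ⟨j, hj⟩ = eC ⟨j₂, hj₂⟩ := by
      apply Fin.ext
      have := congrArg Fin.val h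
      simpa using this
    have := eC.injective h'
    simpa using this
  -- generators
  let G₀ : Matrix (Fin N) (Fin d) ℂ := Matrix.of fun i k => if i ∈ R₀ ∧ k = slotR i then 1 else 0
  let H₁ : Fin r → Fin r → Matrix (Fin N) (Fin d) ℂ := fun a b =>
    Matrix.of fun j k => ∑ i ∈ R₀, if k = slotR i then D a b i j else 0
  let H₀ : Matrix (Fin N) (Fin d) ℂ := Matrix.of fun j k => if j ∈ C₀ ∧ k = slotC j then 1 else 0
  let G₁ : Fin r → Fin r → Matrix (Fin N) (Fin d) ℂ := fun a b =>
    Matrix.of fun i k => ∑ j ∈ C₀, if k = slotC j ∧ i ∉ R₀ then D a b i j else 0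
  -- the two products, entrywise
  have hGH : ∀ a b i j, (G₀ * (H₁ a b)ᵀ) i j = if i ∈ R₀ then D a b i j else 0 := by
    intro a b i j
    simp only [Matrix.mul_apply, Matrix.transpose_apply, G₀, H₁, Matrix.of_apply]
    by_cases hi : i ∈ R₀
    · rw [Finset.sum_eq_single (slotR i)]
      · simp only [hi, true_and, if_true, one_mul]
        rw [Finset.sum_eq_single i]
        · simp
        · intro i₂ hi₂ hne
          have : slotR i ≠ slotR i₂ := fun h => hne (slotR_inj i i₂ hi hi₂ h).symm
          simp [this]
        · intro h; exact absurd hi h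
      · intro k _ hk
        simp [hi, hk]
      · intro h; exact absurd (Finset.mem_univ _) h
    · simp [hi]
  have hGH' : ∀ a b i j, (G₁ a b * H₀ᵀ) i j = if j ∈ C₀ ∧ i ∉ R₀ then D a b i j else 0 := by
    intro a b i j
    simp only [Matrix.mul_apply, Matrix.transpose_apply, G₁, H₀, Matrix.of_apply]
    by_cases hj : j ∈ C₀
    · rw [Finset.sum_eq_single (slotC j)]
      · simp only [hj, true_and, if_true, mul_one]
        rw [Finset.sum_eq_single j]
        · by_cases hi : i ∈ R₀ <;> simp [hi]
        · intro j₂ hj₂ hne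
          have : slotC j ≠ slotC j₂ := fun h => hne (slotC_inj j j₂ hj hj₂ h).symm
          simp [this]
        · intro h; exact absurd hj h
      · intro k _ hk
        simp [hj, hk]
      · intro h; exact absurd (Finset.mem_univ _) h
    · simp [hj]
  -- entries off the break rows/columns vanish
  have hDzero : ∀ a b i j, i ∉ R₀ → j ∉ C₀ → D a b i j = 0 := by
    intro a b i j hi hj
    have hi0 : (i : ℕ) ≠ 0 := fun h => hi (h0R i h)
    have hj0 : (j : ℕ) ≠ 0 := fun h => hj (h0C j h)
    set i' : Fin N := ⟨(i : ℕ) - 1, by omega⟩ with hi'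
    set j' : Fin N := ⟨(j : ℕ) - 1, by omega⟩ with hj'
    have hii' : (i : ℕ) = i' + 1 := by simp [hi']; omega
    have hjj' : (j : ℕ) = j' + 1 := by simp [hj']; omega
    simp only [hD, Matrix.sub_apply]
    rw [conj_apply_succ_succ Z hZ (T a b) i i' j j' hii' hjj', hT a b i j i' j' hii' hjj' hi hj, sub_self]
  refine ⟨G₀, H₀, G₁, H₁, ?_, ?_⟩
  · -- the displacement identity
    intro a b
    ext i j
    change D a b i j = _
    rw [Matrix.add_apply, hGH, hGH']
    by_cases hi : i ∈ R₀
    · simp [hi]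
    · by_cases hj : j ∈ C₀
      · simp [hi, hj]
      · simp [hi, hj, hDzero a b i j hi hj]
  · -- sparsity
    have hH : ∀ a b, (Finset.univ.filter fun p : Fin N × Fin d => H₁ a b p.1 p.2 ≠ 0).card ≤ 2 * d * s := by
      intro a b
      calc (Finset.univ.filter fun p : Fin N × Fin d => H₁ a b p.1 p.2 ≠ 0).card
          ≤ (R₀.biUnion fun i => (Finset.univ.filter fun j : Fin N => D a b i j ≠ 0).image
              fun j => (j, slotR i)).card := by
            apply Finset.card_le_card
            intro p hp
            simp only [Finset.mem_filter, Finset.mem_univ, true_and, H₁, Matrix.of_apply] at hp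
            obtain ⟨i, hiR, hi⟩ := Finset.exists_ne_zero_of_sum_ne_zero hp
            have hk : p.2 = slotR i := by
              by_contra hk; exact hi (by simp [hk])
            have hDij : D a b i p.1 ≠ 0 := by
              intro h0; exact hi (by simp [h0])
            simp only [Finset.mem_biUnion, Finset.mem_image, Finset.mem_filter, Finset.mem_univ, true_and]
            exact ⟨i, hiR, p.1, hDij, Prod.ext rfl hk.symm⟩
        _ ≤ ∑ i ∈ R₀, ((Finset.univ.filter fun j : Fin N => D a b i j ≠ 0).image
              fun j => (j, slotR i)).card := Finset.card_biUnion_le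
        _ ≤ ∑ i ∈ R₀, 2 * s := by
            apply Finset.sum_le_sum
            intro i _
            exact le_trans Finset.card_image_le (card_row_disp_le Z hZ (T a b) i (hrow a b))
        _ = R₀.card * (2 * s) := by simp
        _ ≤ d * (2 * s) := Nat.mul_le_mul_right _ hR
        _ = 2 * d * s := by ring
    have hG : ∀ a b, (Finset.univ.filter fun p : Fin N × Fin d => G₁ a b p.1 p.2 ≠ 0).card ≤ 2 * d * s := by
      intro a b
      calc (Finset.univ.filter fun p : Fin N × Fin d => G₁ a b p.1 p.2 ≠ 0).card
          ≤ (C₀.biUnion fun j => (Finset.univ.filter fun i : Fin N => D a b i j ≠ 0).image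
              fun i => (i, slotC j)).card := by
            apply Finset.card_le_card
            intro p hp
            simp only [Finset.mem_filter, Finset.mem_univ, true_and, G₁, Matrix.of_apply] at hp
            obtain ⟨j, hjC, hj⟩ := Finset.exists_ne_zero_of_sum_ne_zero hp
            have hk : p.2 = slotC j := by
              by_contra hk; exact hj (by simp [hk])
            have hDij : D a b p.1 j ≠ 0 := by
              intro h0; exact hj (by simp [h0])
            simp only [Finset.mem_biUnion, Finset.mem_image, Finset.mem_filter, Finset.mem_univ, true_and]
            exact ⟨j, hjC, p.1, hDij, Prod.ext rfl hk.symm⟩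
        _ ≤ ∑ j ∈ C₀, ((Finset.univ.filter fun i : Fin N => D a b i j ≠ 0).image
              fun i => (i, slotC j)).card := Finset.card_biUnion_le
        _ ≤ ∑ j ∈ C₀, 2 * s := by
            apply Finset.sum_le_sum
            intro j _
            exact le_trans Finset.card_image_le (card_col_disp_le Z hZ (T a b) j (hcol a b))
        _ = C₀.card * (2 * s) := by simp
        _ ≤ d * (2 * s) := Nat.mul_le_mul_right _ hC
        _ = 2 * d * s := by ring
    calc (∑ a : Fin r, ∑ b : Fin r,
          ((Finset.univ.filter fun p : Fin N × Fin d => G₁ a b p.1 p.2 ≠ 0).card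
            + (Finset.univ.filter fun p : Fin N × Fin d => H₁ a b p.1 p.2 ≠ 0).card) : ℕ)
        ≤ ∑ _a : Fin r, ∑ _b : Fin r, (2 * d * s + 2 * d * s) := by
          apply Finset.sum_le_sum; intro a _
          apply Finset.sum_le_sum; intro b _
          exact Nat.add_le_add (hG a b) (hH a b)
      _ = 4 * d * s * r ^ 2 := by simp; ring

end Summit.MatrixMultiplication.MatrixMultiplication.Cruxes.HiddenCorners.Sketch
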